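import Summits.ResolutionOfSingularities.ResolutionOfSingularities.Theorems.PurelyInseparableDim4SwapTransportWindowIterSharpPrime
import Summits.ResolutionOfSingularities.ResolutionOfSingularities.Theorems.PurelyInseparableDim4ResConeCInfCornerWindowPrime
import HarnessLib
import HarnessLib.Audit.Tags

/-!
# Purely inseparable four-folds — THE ♯-VIRTUAL WINDOW IS PLAYED, EVERY PRIME: res-dim4-p-3's finite C∞ game `ResCone.no_cInf_corner_window_prime`
# on the `T + 1` pure virtual slot steps of I♯ (cell `res-dim4-pi`, K2(p) lane, rung-1 POWER-CONE LINE «light pair of TAIL(p, p−1, 3) ∀ p»,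
# flagless branch, FILE ♯7 part B♯ = W5b with the ♯-frame; seat res-dim4-typ-1 g6)

[OURS · counted 0 · cell `res-dim4-pi` · K2(p) lane (holder res-dim4-p-12 g5, rulings g5-23 / g5-26 / g5-27); res-dim4-p-3 g6's MEMO FLAGLESS♯ §4
(«the next letter change starts the window»), port plan §6; the game half is res-dim4-p-3 g5's `…CInfCornerWindowPrime` over res-dim4-p-9's C∞
game.]  Nothing here proves K2(p) for any `p`, any TAIL(p, p−1, 3), FLAGLESS♯, `NoIsolatedTrap p p` or resolution of singularities in dimension
≥ 4 / characteristic `p` — NOT proved.  AI kernel work, weaker than expert review.  This file closes nothing by itself: it reduces a flagless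
light-pair tail to the ENTRY♯ (a ♯-framed virtual partner at ONE real time, res-dim4-p-3's ♯8) plus a virtual letter change, MODULO the
pinning `hVT` taken BY VALUE (row `c`; holder g5-26).

**`virtual_window_false_of_entry_sharp_prime`** — given an ENTRY♯ at real time `k` (relation along `π₀`, the ♯-frame of `Bs 0` at jet `N`), a
common isolation certificate level `Nc` of `c k, …, c (k+T+2)`, the real regime up to `k + T + 2` (one more than the game: the look-ahead),
the virtual data of the recursion rule, `T ≥ 4(d − 1) + 2`, budgets `Nc + 3p + 2 + p(T+1) ≤ M`, `d + 5 + d(T+1) ≤ N`, and a virtual letter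
change at the start (`ℓs 0 = λ`, `ℓs 1 = μ`): `False` — I♯ `virtual_iterate_sharp_prime` for `T + 1` steps, the two residual readings at
`Bs 0` by `straight_readings_of_resForm_prime`, then `ResCone.no_cInf_corner_window_prime` on `Bs`.
[cite: Hauser2010, §§F–G] [cite: CossartJannsenSaito2020, Thm. 3.14]
bears_on: LADDER-RESOLUTION:D157-DOOR2 (res-dim4-pi · K2(p) · power cones · flagless branch ♯7 ♯-window played).  Supports
stmt-ResolutionOfSingularities-16155 (helper).
-/

set_option linter.dupNamespace false -- mandated namespace of this single-conjunct summit

noncomputable section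

namespace Summit.ResolutionOfSingularities.ResolutionOfSingularities.Theorems.PIDim4

namespace SwapTransport

open MvPolynomial Finset
open Literature.AlgebraicGeometry.Resolution
open Literature.AlgebraicGeometry.Resolution.CentreBlowup
open Literature.AlgebraicGeometry.Resolution.Hauser2010
open Literature.AlgebraicGeometry.Resolution.HauserPerlega2019

variable {K : Type} [Field K] [DecidableEq K]

/-- **THE ♯-VIRTUAL WINDOW IS PLAYED, every prime** (module docstring): from an ENTRY♯ at real time `k`, `T + 1` shadowed steps
(`virtual_iterate_sharp_prime`), `T ≥ 4(d − 1) + 2`, and res-dim4-p-3's `ResCone.no_cInf_corner_window_prime` on the shadow. [OURS]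
[cite: Hauser2010, §§F–G] [cite: CossartJannsenSaito2020, Thm. 3.14] -/
theorem virtual_window_false_of_entry_sharp_prime (p : ℕ) [Fact p.Prime] [CharP K p] {d ef : ℕ} (hdp : d + 1 = p) (hef : ef + 3 ≤ d)
    {la mu u f : Fin 4} (hlm : la ≠ mu) (hlu : la ≠ u) (hlf : la ≠ f) (hmu : mu ≠ u) (hmf : mu ≠ f) (huf : u ≠ f)
    (hVT : ∀ (x y : Fin 4) (B : State K) (β : K), x ≠ y → x ≠ u → x ≠ f → y ≠ u → y ≠ f →
      ordZero B.F = ((d + 2 : ℕ) : ℕ∞) → (∀ e ∈ B.F.support, e f = ef → 3 ≤ e x) →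
      coeff (Finsupp.single x 4 + Finsupp.single y 3 + Finsupp.single u (d - 3 - ef) + Finsupp.single f ef) B.F = 0 →
      coeff (Finsupp.single x 3 + Finsupp.single y 3 + Finsupp.single u (d - 2 - ef) + Finsupp.single f ef) B.F ≠ 0 →
      coeff (Finsupp.single x 3 + Finsupp.single y 3 + Finsupp.single u (d - 3 - ef) + Finsupp.single f ef)
        (CentreBlowup.step p Finset.univ x (Function.update (0 : Fin 4 → K) u β) B).F = 0 → β = 0)
    {c : ℕ → State K} {j : ℕ → Fin 4} {b : ℕ → Fin 4 → K} (hw : FreeTail.IsWitnessedChain p c j b) {k Nc T : ℕ}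
    (hT : 4 * (d - 1) + 2 ≤ T) (hisoR : ∀ t, t ≤ T + 2 → IsIsolated p (c (k + t)).F)
    (hcert : ∀ t, t ≤ T + 2 → originIdeal K ^ Nc ≤ singLocusIdeal p (c (k + t)).F ⊔ originIdeal K ^ (Nc + 1))
    (hoR : ∀ t, t ≤ T + 2 → ordZero (c (k + t)).F = ((d + 2 : ℕ) : ℕ∞))
    (he3R : ∀ t, t ≤ T + 2 → Module.finrank K (ResCone.resVertex (c (k + t))) = 3)
    (hwtR : ∀ t, t ≤ T + 2 → (∀ i, (c (k + t)).r i ≤ 1) ∧ (c (k + t)).r.degree = 2)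
    (hdivR : ∀ t, t ≤ T + 2 → ∀ e ∈ (c (k + t)).F.support, (c (k + t)).r ≤ e)
    {πs : ℕ → Equiv.Perm (Fin 4)} {Bs : ℕ → State K} {ℓs : ℕ → Fin 4}
    (hBs : ∀ t, Bs (t + 1) = CentreBlowup.step p Finset.univ (ℓs t) 0 (Bs t))
    (hℓs : ∀ t, ℓs t = if j (k + t) = πs t la then la else if j (k + t) = πs t mu then mu
      else if b (k + t) (πs t la) ≠ 0 then la else mu)
    (hπs : ∀ t, πs (t + 1) = if j (k + t) = πs t la ∨ j (k + t) = πs t mu then πs t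
      else (Equiv.swap (ℓs t) ((πs t).symm (j (k + t)))).trans (πs t))
    {M N : ℕ} (hM : Nc + 3 * p + 2 + p * (T + 1) ≤ M) (hN : d + 5 + d * (T + 1) ≤ N)
    (hrel0 : ∃ (θ e : Fin 4 → MvPolynomial (Fin 4) K) (U E : MvPolynomial (Fin 4) K),
      θ (πs 0 la) = X la * e la ∧ θ (πs 0 mu) = X mu * e mu ∧ constantCoeff (e la) ≠ 0 ∧ constantCoeff (e mu) ≠ 0 ∧
      constantCoeff (θ (πs 0 u)) = 0 ∧ constantCoeff (θ (πs 0 f)) = 0 ∧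
      coeff (Finsupp.single u 1) (θ (πs 0 u)) * coeff (Finsupp.single f 1) (θ (πs 0 f)) -
        coeff (Finsupp.single f 1) (θ (πs 0 u)) * coeff (Finsupp.single u 1) (θ (πs 0 f)) ≠ 0 ∧
      constantCoeff U ≠ 0 ∧ E ∈ originIdeal K ^ M ∧ (Bs 0).F = deletePthPowers p (U ^ p * aeval θ (c k).F) + E)
    (hrA0 : (c k).r = Finsupp.single (πs 0 la) 1 + Finsupp.single (πs 0 mu) 1)
    (hfr0 : ordZero (Bs 0).F = ((d + 2 : ℕ) : ℕ∞) ∧ (Bs 0).r = Finsupp.single la 1 + Finsupp.single mu 1 ∧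
      (∀ e ∈ (Bs 0).F.support, (Bs 0).r ≤ e) ∧ (∃ a : K, a ≠ 0 ∧ ResCone.resForm (Bs 0) = C a * X f ^ d) ∧
      (∀ e ∈ (Bs 0).F.support, e.degree = d + 2 →
        e = Finsupp.single la 1 + Finsupp.single mu 1 + Finsupp.single u 0 + Finsupp.single f d) ∧
      (∀ e ∈ (Bs 0).F.support, e f ≤ d - 1 → 2 ≤ e la ∧ 2 ≤ e mu) ∧
      (∀ e ∈ (Bs 0).F.support, e f + 2 ≤ d → 3 ≤ e la) ∧ (∀ e ∈ (Bs 0).F.support, e f + 2 ≤ d → 3 ≤ e mu) ∧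
      (∀ E : Fin 4 →₀ ℕ, E.degree = d + 3 → E f + 2 ≤ d → coeff E (Bs 0).F = 0) ∧
      (∀ e ∈ (Bs 0).F.support, e.degree < N → ¬ (e u = d - 3 - ef ∧ e f = ef)) ∧
      coeff (Finsupp.single la 3 + Finsupp.single mu 3 + Finsupp.single u (d - 2 - ef) + Finsupp.single f ef) (Bs 0).F ≠ 0 ∧
      IsIsolated p (Bs 0).F ∧ Module.finrank K (ResCone.resVertex (Bs 0)) = 3)
    (hx0 : ℓs 0 = la) (hx1 : ℓs 1 = mu) : False := by
  have hd2 : 2 ≤ d := by omega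
  have hP := virtual_iterate_sharp_prime p hdp hef hlm hlu hlf hmu hmf huf hVT hw (T := T + 1) hisoR hcert hoR he3R hwtR hdivR hBs hℓs
    hπs hM hN hrel0 hrA0 hfr0
  have hslot : ∀ t, t ≤ T → ℓs t = la ∨ ℓs t = mu := fun t _ => by
    rw [hℓs t]
    split_ifs
    exacts [Or.inl rfl, Or.inr rfl, Or.inl rfl, Or.inr rfl]
  -- the two residual readings of the first virtual state, from its frame
  obtain ⟨a, ha, hform0⟩ := hfr0.2.2.2.1
  have hrdeg0 : (Bs 0).r.degree = 2 := by rw [hfr0.2.1, map_add, Finsupp.degree_single, Finsupp.degree_single]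
  obtain ⟨ha0, hstraight0⟩ := ResCone.straight_readings_of_resForm_prime hfr0.1 hrdeg0 hform0
  exact ResCone.no_cInf_corner_window_prime hlm hlu hlf hmu hmf huf p hdp hd2 hT (c := Bs) (j := ℓs)
    (fun t ht => (hP t ht).2.2.2.2.2.2.2.2.2.2.2.2.2.1) (fun t ht => (hP t ht).2.2.1) (fun t ht => (hP t ht).2.2.2.2.2.2.2.2.2.2.2.2.2.2)
    (fun t ht => (hP t ht).2.2.2.2.1) (fun t _ => hBs t) hslot (fun t ht => (hP t ht).2.2.2.1) (by rw [ha0]; exact ha) hstraight0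
    hfr0.2.2.2.2.2.1 hx0 hx1

end SwapTransport

end Summit.ResolutionOfSingularities.ResolutionOfSingularities.Theorems.PIDim4

end
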